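import Literature.Computability.AlgebraicComplexity.SymmetricArithCircuit
import Literature.Computability.AlgebraicComplexity.StandardFamilies
import Literature.LinearAlgebra.Matrix.FaddeevLeVerrier
import Mathlib.Tactic.DeriveFintype
import Mathlib.Tactic.Ring
import Mathlib.Tactic.Linarith
import HarnessLib

/-!
# Le Verrier's symmetric circuit for the determinant (Dawar–Wilsenach, Theorem 4.1): the circuit

Topic `Computability/AlgebraicComplexity`; companion of `SymmetricArithCircuit.lean` (Dawar–Wilsenach's
symmetric arithmetic circuits: `LabelledArithCircuit` = Def. 2.2, `IsSymmetric` = Def. 3.7,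
`SymmetricArithmeticCircuit` = the bundled form; layout as in `SymmetricArithCircuitNaive.lean`).
Correctness and size are in `SymmetricDetCircuitEval.lean`.

A. Dawar, G. Wilsenach, *Symmetric Arithmetic Circuits*, Theory of Computing 21 (14) (2025),
**Theorem 4.1**: over a field of characteristic `0` the family `{DET_n}` is computed by
polynomial-size *symmetric* circuits — symmetric under simultaneous row/column permutations
`x_ij ↦ x_{σ i σ j}` (and even under transposition) — by **Le Verrier's method**: the coefficients of
the characteristic polynomial are obtained from traces by exact divisions by `1, …, n`, and every
intermediate quantity is a matrix entry, a trace or a coefficient, on which `Sym_n` acts by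
relabelling indices.

We realise Le Verrier's method in its Faddeev–LeVerrier form, whose algebra is already in the tree
(`Literature/LinearAlgebra/Matrix/FaddeevLeVerrier.lean`: for `M` with `χ_M = ∑ c_k X^k` and
`N_l = flMat M l`: `N_{n-1} = 1`, `N_{l-1} = M N_l + c_l 1`, `(n − l) c_l = −tr(M N_l)`,
`c_0 = det(−M)`), applied to `M = −X` for the generic matrix `X = (x_ij)`, so that the output is
`c_0 = det X`:

* gates (`LeVerrierGate n`): the inputs `x_ij`; constants `0`, `1` and `κ_l = −1/(n − l)`
  (`l < n`; `κ_{n-1} = −1` doubles as the sign of `M = −X`); for every level `l < n` the entries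
  `N_l(i,j)` (sum gates: `N_{n-1}(i,j)` has the single child `1` or `0`; for `l < n − 1` the children
  are `(M N_{l+1})(i,j)` and, on the diagonal, `c_{l+1}`), the products
  `P_l(i,k,j) = κ_{n-1} · x_ik · N_l(k,j) = M_ik N_l(k,j)`, the entries `(M N_l)(i,j) = ∑_k P_l(i,k,j)`,
  the traces `t_l = ∑_i (M N_l)(i,i)` and the coefficients `c_l = κ_l · t_l`;
* `leVerrierCircuit K n` — the `LabelledArithCircuit` on these gates with output `c_0` (for `n = 0`
  the output is the constant gate `1`, the determinant of the empty matrix);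
* `symLeVerrierCircuit K n` — the same circuit with `Sym_n` acting on gates by relabelling the
  indices `i, j, k` (levels and constants fixed): a `SymmetricArithmeticCircuit`, hence
  `IsSymmetric (Equiv.Perm (Fin n))` (`isSymmetric_leVerrierCircuit`), for ANY action on the
  one-element output index type.

This calibrates symmetric-circuit lower bounds (the permanent has no subexponential symmetric circuits,
Dawar–Wilsenach Thm. 7.1, `DawarWilsenach2025.lean`). Everything here is proved. Deliberately NOT
here: transpose-symmetry (only the diagonal `Sym_n` is treated), rigidity, uniformity.
-/
noncomputable section

namespace Literature.Computability.AlgebraicComplexity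

open MvPolynomial

universe u

/-! ### Gates and the action of `Sym_n` -/

/-- Gates of Le Verrier's determinant circuit for the `n × n` generic matrix: inputs `x_ij`,
constants `0`, `1`, `κ_l = −1/(n−l)`, and for each level `l < n` the entries `N_l(i,j)` of the
Faddeev–LeVerrier matrix, the products `M_ik · N_l(k,j)`, the entries `(M N_l)(i,j)`, the trace
`tr(M N_l)` and the coefficient `c_l` (`M = −X`). [cite: DawarWilsenach2025, Thm. 4.1] -/
inductive LeVerrierGate (n : ℕ) : Type
  /-- Input gate for the variable `x_ij`. -/
  | inp (x : Fin n × Fin n) : LeVerrierGate n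
  /-- The constant `0`. -/
  | zero : LeVerrierGate n
  /-- The constant `1`. -/
  | one : LeVerrierGate n
  /-- The constant `κ_l = −1/(n − l)`. -/
  | cst (l : Fin n) : LeVerrierGate n
  /-- The entry `N_l(i,j)` of the `l`-th Faddeev–LeVerrier matrix. -/
  | nmat (l : Fin n) (i j : Fin n) : LeVerrierGate n
  /-- The product `κ_{n-1} · x_ik · N_l(k,j) = M_ik N_l(k,j)`. -/
  | prd (l : Fin n) (i k j : Fin n) : LeVerrierGate n
  /-- The entry `(M N_l)(i,j) = ∑_k M_ik N_l(k,j)`. -/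
  | xn (l : Fin n) (i j : Fin n) : LeVerrierGate n
  /-- The trace `tr(M N_l)`. -/
  | tr (l : Fin n) : LeVerrierGate n
  /-- The coefficient `c_l = κ_l · tr(M N_l)` of the characteristic polynomial of `M`. -/
  | coef (l : Fin n) : LeVerrierGate n
  deriving DecidableEq, Fintype

namespace LeVerrierGate

variable {n : ℕ}

/-- `Sym_n` acts on the gates by relabelling the matrix indices (levels and constants are fixed).
[cite: DawarWilsenach2025, Thm. 4.1] -/
instance instMulAction : MulAction (Equiv.Perm (Fin n)) (LeVerrierGate n) where
  smul σ
    | inp x => inp (σ • x)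
    | zero => zero
    | one => one
    | cst l => cst l
    | nmat l i j => nmat l (σ i) (σ j)
    | prd l i k j => prd l (σ i) (σ k) (σ j)
    | xn l i j => xn l (σ i) (σ j)
    | tr l => tr l
    | coef l => coef l
  one_smul g := by cases g <;> rfl
  mul_smul σ τ g := by cases g <;> rfl

/-- The action on input gates. [folklore] -/
@[simp] theorem smul_inp (σ : Equiv.Perm (Fin n)) (x : Fin n × Fin n) : σ • inp x = inp (σ • x) := rfl

/-- The constant `0` is fixed. [folklore] -/
@[simp] theorem smul_zero_gate (σ : Equiv.Perm (Fin n)) : σ • (zero : LeVerrierGate n) = zero := rfl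

/-- The constant `1` is fixed. [folklore] -/
@[simp] theorem smul_one_gate (σ : Equiv.Perm (Fin n)) : σ • (one : LeVerrierGate n) = one := rfl

/-- The constants `κ_l` are fixed. [folklore] -/
@[simp] theorem smul_cst (σ : Equiv.Perm (Fin n)) (l : Fin n) : σ • cst l = cst l := rfl

/-- The action on the entries `N_l(i,j)`. [folklore] -/
@[simp] theorem smul_nmat (σ : Equiv.Perm (Fin n)) (l i j : Fin n) :
    σ • nmat l i j = nmat l (σ i) (σ j) := rfl

/-- The action on the product gates. [folklore] -/
@[simp] theorem smul_prd (σ : Equiv.Perm (Fin n)) (l i k j : Fin n) :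
    σ • prd l i k j = prd l (σ i) (σ k) (σ j) := rfl

/-- The action on the entries `(M N_l)(i,j)`. [folklore] -/
@[simp] theorem smul_xn (σ : Equiv.Perm (Fin n)) (l i j : Fin n) :
    σ • xn l i j = xn l (σ i) (σ j) := rfl

/-- The traces are fixed. [folklore] -/
@[simp] theorem smul_tr (σ : Equiv.Perm (Fin n)) (l : Fin n) : σ • tr l = tr l := rfl

/-- The coefficients are fixed. [folklore] -/
@[simp] theorem smul_coef (σ : Equiv.Perm (Fin n)) (l : Fin n) : σ • coef l = coef l := rfl

/-- The top level `n − 1` as an element of `Fin n` (any level witnesses `0 < n`). [folklore] -/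
def top (l : Fin n) : Fin n := ⟨n - 1, by have := l.isLt; omega⟩

/-- The value of `top`. [folklore] -/
@[simp] theorem top_val (l : Fin n) : (top l : ℕ) = n - 1 := rfl

/-- Rank of a gate, used for acyclicity: inputs and constants `0`; at level `l` (processed from
`l = n − 1` downwards) `N_l ≺ P_l ≺ M N_l ≺ tr ≺ c_l ≺ N_{l-1}`. [folklore] -/
def rank : LeVerrierGate n → ℕ
  | inp _ => 0
  | zero => 0
  | one => 0
  | cst _ => 0
  | nmat l _ _ => 5 * (n - 1 - l) + 1
  | prd l _ _ _ => 5 * (n - 1 - l) + 2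
  | xn l _ _ => 5 * (n - 1 - l) + 3
  | tr l => 5 * (n - 1 - l) + 4
  | coef l => 5 * (n - 1 - l) + 5

/-- Children (wires) of Le Verrier's circuit. [cite: DawarWilsenach2025, Thm. 4.1] -/
def children : LeVerrierGate n → Finset (LeVerrierGate n)
  | inp _ => ∅
  | zero => ∅
  | one => ∅
  | cst _ => ∅
  | nmat l i j =>
      if h : (l : ℕ) + 1 < n then
        insert (xn ⟨l + 1, h⟩ i j) (if i = j then {coef ⟨l + 1, h⟩} else ∅)
      else if i = j then {one} else {zero}
  | prd l i k j => {cst (top l), inp (i, k), nmat l k j}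
  | xn l i j => Finset.univ.image fun k => prd l i k j
  | tr l => Finset.univ.image fun i => xn l i i
  | coef l => {cst l, tr l}

/-- Labels of Le Verrier's circuit over a field `K`: variables, the constants `0`, `1`,
`κ_l = −1/(n−l)`, and `+` / `×`. [cite: DawarWilsenach2025, Thm. 4.1] -/
def label (K : Type u) [Field K] : LeVerrierGate n → CircuitLabel K (Fin n × Fin n)
  | inp x => .var x
  | zero => .const 0
  | one => .const 1
  | cst l => .const (-((n - l : ℕ) : K)⁻¹)
  | nmat _ _ _ => .add
  | prd _ _ _ _ => .mul
  | xn _ _ _ => .add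
  | tr _ => .add
  | coef _ => .mul

/-- Children have smaller rank. [folklore] -/
theorem rank_lt_of_mem_children {g h : LeVerrierGate n} (hh : h ∈ children g) : rank h < rank g := by
  cases g with
  | inp x => simp [children] at hh
  | zero => simp [children] at hh
  | one => simp [children] at hh
  | cst l => simp [children] at hh
  | nmat l i j =>
    simp only [children] at hh
    by_cases h1 : (l : ℕ) + 1 < n
    · rw [dif_pos h1] at hh
      by_cases hij : i = j
      · rw [if_pos hij, Finset.mem_insert, Finset.mem_singleton] at hh
        rcases hh with rfl | rfl
        · simp only [rank]; omega
        · simp only [rank]; omega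
      · rw [if_neg hij, Finset.mem_insert] at hh
        rcases hh with rfl | hh
        · simp only [rank]; omega
        · simp at hh
    · rw [dif_neg h1] at hh
      by_cases hij : i = j
      · rw [if_pos hij, Finset.mem_singleton] at hh
        subst hh; simp [rank]
      · rw [if_neg hij, Finset.mem_singleton] at hh
        subst hh; simp [rank]
  | prd l i k j =>
    simp only [children, Finset.mem_insert, Finset.mem_singleton] at hh
    rcases hh with rfl | rfl | rfl
    · simp [rank]
    · simp [rank]
    · simp only [rank]; omega
  | xn l i j =>
    simp only [children, Finset.mem_image, Finset.mem_univ, true_and] at hh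
    obtain ⟨k, rfl⟩ := hh
    simp only [rank]; omega
  | tr l =>
    simp only [children, Finset.mem_image, Finset.mem_univ, true_and] at hh
    obtain ⟨i, rfl⟩ := hh
    simp only [rank]; omega
  | coef l =>
    simp only [children, Finset.mem_insert, Finset.mem_singleton] at hh
    rcases hh with rfl | rfl
    · simp [rank]
    · simp only [rank]; omega

section Consts

variable {K : Type u} [DivisionRing K] [CharZero K]

/-- `−1/m ≠ 1` in characteristic `0`. [folklore] -/
theorem neg_inv_natCast_ne_one (m : ℕ) : -((m : K))⁻¹ ≠ 1 := by
  intro h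
  have h1 : ((m : K))⁻¹ = -1 := by rw [← h, neg_neg]
  have h2 : (m : K) = -1 := by rw [← inv_inv (m : K), h1, inv_neg, inv_one]
  have h3 : ((m + 1 : ℕ) : K) = 0 := by rw [Nat.cast_succ, h2, neg_add_cancel]
  exact Nat.succ_ne_zero m (Nat.cast_eq_zero.1 h3)

/-- `m ↦ −1/m` is injective in characteristic `0`. [folklore] -/
theorem natCast_eq_of_neg_inv_eq {m m' : ℕ} (h : -((m : K))⁻¹ = -((m' : K))⁻¹) : m = m' := by
  have := inv_injective (neg_injective h)
  exact_mod_cast this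

end Consts

end LeVerrierGate

/-! ### The circuit -/

open LeVerrierGate in
/-- **Le Verrier's circuit for `DET_n`** (Dawar–Wilsenach Thm. 4.1, in Faddeev–LeVerrier form) as a
labelled arithmetic circuit over a field `K` of characteristic `0` on the gates `LeVerrierGate n`,
with the single output `c_0 = det X` (`n ≥ 1`) resp. the constant `1` (`n = 0`).
[cite: DawarWilsenach2025, Thm. 4.1] -/
def leVerrierCircuit (K : Type u) [Field K] [CharZero K] (n : ℕ) :
    LabelledArithCircuit K (Fin n × Fin n) Unit (LeVerrierGate n) where
  children := children
  label := label K
  output _ := if h : 0 < n then coef ⟨0, h⟩ else one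
  wf := Subrelation.wf (fun {_ _} hh => rank_lt_of_mem_children hh)
    (InvImage.wf LeVerrierGate.rank Nat.lt_wfRel.wf)
  isInput_iff g := by
    cases g with
    | inp x => simp [label, children]
    | zero => simp [label, children]
    | one => simp [label, children]
    | cst l => simp [label, children]
    | nmat l i j =>
      simp only [label, CircuitLabel.not_isInput_add, false_iff, children]
      split_ifs <;> simp
    | prd l i k j => simp [label, children]
    | xn l i j =>
      simp only [label, CircuitLabel.not_isInput_add, false_iff, children, Finset.image_eq_empty,
        Finset.univ_eq_empty_iff]
      exact fun h => h.elim i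
    | tr l =>
      simp only [label, CircuitLabel.not_isInput_add, false_iff, children, Finset.image_eq_empty,
        Finset.univ_eq_empty_iff]
      exact fun h => h.elim l
    | coef l => simp [label, children]
  eq_of_label_eq g g' hg hl := by
    cases g with
    | inp x =>
      cases g' <;> simp [label] at hl
      rw [hl]
    | zero =>
      cases g' with
      | zero => rfl
      | cst l =>
        simp only [label, CircuitLabel.const.injEq, zero_eq_neg, inv_eq_zero, Nat.cast_eq_zero] at hl
        have := l.isLt; omega
      | _ => simp [label] at hl
    | one =>
      cases g' with
      | one => rfl
      | cst l =>
        simp only [label, CircuitLabel.const.injEq] at hl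
        exact absurd hl.symm (neg_inv_natCast_ne_one _)
      | _ => simp [label] at hl
    | cst l =>
      cases g' with
      | cst l' =>
        simp only [label, CircuitLabel.const.injEq] at hl
        have h := natCast_eq_of_neg_inv_eq hl
        have := l.isLt; have := l'.isLt
        congr 1; ext; omega
      | zero =>
        simp only [label, CircuitLabel.const.injEq, neg_eq_zero, inv_eq_zero, Nat.cast_eq_zero] at hl
        have := l.isLt; omega
      | one =>
        simp only [label, CircuitLabel.const.injEq] at hl
        exact absurd hl (neg_inv_natCast_ne_one _)
      | _ => simp [label] at hl
    | nmat l i j => simp [label] at hg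
    | prd l i k j => simp [label] at hg
    | xn l i j => simp [label] at hg
    | tr l => simp [label] at hg
    | coef l => simp [label] at hg
  output_injective := fun _ _ _ => rfl

open LeVerrierGate in
/-- **Le Verrier's circuit is `Sym_n`-symmetric**: with `Sym_n` relabelling the indices of the
gates, every `σ` acts as a circuit automorphism extending the diagonal action `x_ij ↦ x_{σ i σ j}`
(for any action on the one-element output index type). [cite: DawarWilsenach2025, Thm. 4.1] -/
def symLeVerrierCircuit (K : Type u) [Field K] [CharZero K] (n : ℕ)
    [MulAction (Equiv.Perm (Fin n)) Unit] :
    SymmetricArithmeticCircuit (Equiv.Perm (Fin n)) K (Fin n × Fin n) Unit (LeVerrierGate n) where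
  toLabelledArithCircuit := leVerrierCircuit K n
  children_smul σ g := by
    change children (σ • g) = (children g).map _
    cases g with
    | inp x => simp [children]
    | zero => simp [children]
    | one => simp [children]
    | cst l => simp [children]
    | nmat l i j =>
      have hij : σ i = σ j ↔ i = j := σ.injective.eq_iff
      simp only [smul_nmat, children]
      by_cases h1 : (l : ℕ) + 1 < n
      · rw [dif_pos h1, dif_pos h1]
        by_cases h : i = j
        · subst h
          simp
        · rw [if_neg (mt hij.1 h), if_neg h]
          simp
      · rw [dif_neg h1, dif_neg h1]
        by_cases h : i = j
        · subst h; simp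
        · rw [if_neg (mt hij.1 h), if_neg h]; simp
    | prd l i k j =>
      simp [children, Finset.map_insert, Finset.map_singleton]
    | xn l i j =>
      ext h
      simp only [smul_xn, children, Finset.mem_image, Finset.mem_univ, true_and, Finset.mem_map,
        Equiv.toEmbedding_apply, MulAction.toPerm_apply]
      constructor
      · rintro ⟨k, rfl⟩
        exact ⟨prd l i (σ.symm k) j, ⟨σ.symm k, rfl⟩, by simp⟩
      · rintro ⟨_, ⟨k, rfl⟩, rfl⟩
        exact ⟨σ k, rfl⟩
    | tr l =>
      ext h
      simp only [smul_tr, children, Finset.mem_image, Finset.mem_univ, true_and, Finset.mem_map,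
        Equiv.toEmbedding_apply, MulAction.toPerm_apply]
      constructor
      · rintro ⟨i, rfl⟩
        exact ⟨xn l (σ.symm i) (σ.symm i), ⟨σ.symm i, rfl⟩, by simp⟩
      · rintro ⟨_, ⟨i, rfl⟩, rfl⟩
        exact ⟨σ i, rfl⟩
    | coef l =>
      simp [children, Finset.map_insert, Finset.map_singleton]
  label_smul σ g := by cases g <;> rfl
  output_smul σ y := by
    change (if h : 0 < n then coef ⟨0, h⟩ else one) = σ • (if h : 0 < n then coef ⟨0, h⟩ else one)
    split_ifs <;> rfl

/-- Le Verrier's circuit is `Sym_n`-symmetric (Dawar–Wilsenach Def. 3.7) for the diagonal action on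
the variable matrix, whatever the (necessarily trivial) action on the output index.
[cite: DawarWilsenach2025, Thm. 4.1] -/
theorem isSymmetric_leVerrierCircuit (K : Type u) [Field K] [CharZero K] (n : ℕ)
    [MulAction (Equiv.Perm (Fin n)) Unit] :
    (leVerrierCircuit K n).IsSymmetric (Equiv.Perm (Fin n)) :=
  (symLeVerrierCircuit K n).isSymmetric

/-! ### The matrix of the recursion -/

/-- The matrix the Faddeev–LeVerrier recursion runs on: `M = −X` for the generic matrix
`X = (x_ij)` (so that `c_0 = det(−M) = det X`). [folklore] -/
def leVerrierMatrix (K : Type u) [Field K] (n : ℕ) : Matrix (Fin n) (Fin n) (MvPolynomial (Fin n × Fin n) K) :=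
  -Matrix.mvPolynomialX (Fin n) (Fin n) K

/-- Entries of `M = −X`. [folklore] -/
theorem leVerrierMatrix_apply (K : Type u) [Field K] {n : ℕ} (i j : Fin n) :
    leVerrierMatrix K n i j = -MvPolynomial.X (i, j) := by
  rw [leVerrierMatrix, Matrix.neg_apply, Matrix.mvPolynomialX_apply]

end Literature.Computability.AlgebraicComplexity

end
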